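import Literature.Analysis.FluidPDE.Tao2016AveragedNS.GateRetuning
import Literature.Analysis.FluidPDE.Tao2016AveragedNS.TriggerFragility
import HarnessLib

/-!
# The trigger ceiling of the retuned family: kicks above `seed × K⁷³⁺ᵒ⁽¹⁾` fire the gate early

Framing (page 1, mandatory): low prior, high value-of-information experiment on Tao's machine
paradigm; NOT a claim that NS blows up.

`TriggerToleranceWith.lean` is the LOWER side of the trigger channel of the retuned family
`delayCircuitWith K M ε` (`3000 log K ≤ M ≤ K¹⁰`): a pre-load `κ ≤ kickToleranceWith K M ε =
ε²e^{-M}K¹⁰ = seed × K¹⁰` of the trigger mode `c` is absorbed and Theorem 5.3 holds verbatim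
(`kickTransitionWith_explicit`). This file is the UPPER side, the family version of
`TriggerFragility.lean`: a pre-load

  `κ ≥ kickCeilingWith K M ε γ s = 2K¹⁰ε² · exp(-M(1 - 2γ - 4MK²⁰ε²)s²/2)`

(`κ ≤ ε²`) is INCOMPATIBLE with the quiet-phase bounds `a ≥ 1 - γ`, `|d| ≤ γ`, `|ã| ≤ γ` on
`[0, s + 1/(2K¹⁰)]` for EVERY global solution from `kickInit κ` (`kickW_core`): the clock
`κe^{M(1-2γ-…)t²/2}` brings the trigger to the level `2K¹⁰ε²` by time `s`, the rotor then turns `d`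
by `1/2 > 2γ` within `1/(2K¹⁰)`. Specialised to the quiet phase that Theorem 5.3 certifies
(`γ = 200K⁻¹⁰` up to `√2 - 44 log K / M`, `QuietUpTo`), the two sides read

* `κ ≤ ε²e^{-M}K¹⁰`                       ⇒ quiet up to `√2 - 44 log K/M` (`TriggerToleranceWith.lean`,
  assembled with this file in `TriggerChannelWith.lean`: `quietUpTo_of_le_kickToleranceWith`);
* `ε² ≥ κ ≥ 2e^{400M/K¹⁰ + 2} · ε²e^{-M}K⁷³` ⇒ NOT quiet up to `√2 - 44 log K/M`
  (`not_quietUpTo_of_kickCeilingWith_le`, `kickCeilingWith_le`),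

so the undetermined window of pre-loads spans a factor `≤ 2e^{400M/K¹⁰+2}K⁶³` — POLYNOMIAL in `K`,
uniformly in `M` (the `e^{400M/K¹⁰} ≤ e^{400}` is the bookkeeping price of the window tolerance
`γ = 200K⁻¹⁰` over `M ≤ K¹⁰` e-folds; for the logarithmic members `M = p log K`, `400p ≤ K⁹`, it is
`≤ e`, `kickCeilingWith_log_le`: ceiling `≤ 2e³ε²K^{73-p}` against tolerance `ε²K^{10-p}`).
Contrast Tao's member `M = K¹⁰` (`TriggerFragility` / `TriggerTolerance`): tolerance
`ε²e^{-K¹⁰+K⁹√K/4}`, threshold `2K¹⁰ε²e^{-K¹⁰(1-o(1))s²/2}` — both doubly exponential in the size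
parameter. For the machine paradigm: the retuned gate's trigger input has a polynomially-resolved
switching band `[seed·K¹⁰, seed·O(K⁷³)]`, below which it provably waits and above which it
provably fires early.

## Files

This file imports only `GateRetuning.lean` (the family) and `TriggerFragility.lean` (the kicked
datum `kickInit`, `kickThreshold`): the ceiling is a property of the kicked dynamics alone and does
not use the proof of Theorem 5.3. The lower side (`TriggerToleranceWith.lean`, which imports
`RetunedTransition.lean`) and the two-sided statement under the standing hypotheses of the family
(`TriggerChannelWith.lean`: `triggerChannelWith`) are separate files.

## Method

`kickW_b_le` … `kickW_core` are `kick_b_le` … `kick_core` of `TriggerFragility.lean` ported to the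
family: the amplifier `ε⁻¹K¹⁰ ↦ ε⁻¹M`, the seed `e^{-K¹⁰} ↦ e^{-M}`, the penalty `4K³⁰ε² ↦ 4MK²⁰ε²`,
the hypothesis `13K¹⁵ε ≤ 1 ↦ 169MK²⁰ε² ≤ 1`, the Grönwall rate `2K¹⁰ ↦ 2M` (harmless over the step
`1/(2K¹⁰)` because `M ≤ K¹⁰`); the rotor step (`kickW_d_growth`), the level `2K¹⁰ε²`, the step
`1/(2K¹⁰)` and the cap `9K¹⁰ε²` are unchanged (the rotor is not retuned). Energy conservation
(`delayCircuitWith_energy`), the `Thm53` toolkit of `DelayCircuitHolds.lean`, `e < 3`, `√2 < 71/50`.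
No named facts, no axioms; two definitions (`kickCeilingWith`, `QuietUpTo`).

## Numerical illustration (evidence file only; no constant of this file depends on it)

Cell job `j050521` (`code/bp1-num/kickband.py`; `K = 16`, `ε = 0.003`, `M ∈ {5, 10, 20}` — illustrative
sizes, far below `K ≥ 2·20⁴²·42!`): from `kickInit κ` with `κ = kseed·10^{j/2}`,
`kseed = ε²e^{-M}√(π/2M)` (the seed's effective pre-load), the half-firing time of the output obeys
`t₅₀(κ)² ≈ t₅₀(0)² - (2/M)·ln(1 + κ/kseed)` with no fitted constant (at `M = 20`: residual
`-0.001 … -0.04` over the first 4.5 decades of `κ/kseed`, `-0.27` at `κ = ε²`). A factor `F` in the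
pre-load costs `(2/M)·ln F` in `t₅₀²` — the clock `κe^{Mt²/2}` of `kickW_c_lower` read numerically;
on `M = p log K` a factor `K^C` costs `2C/p`.

## References

* [Tao2016AveragedNS] T. Tao, Finite time blowup for an averaged three-dimensional Navier–Stokes
  equation, J. Amer. Math. Soc. 29 (2016), Theorem 5.3 and §5.5, (5.5)–(5.6), pp. 28–30.
-/

noncomputable section

namespace Literature.Analysis.FluidPDE.Tao2016AveragedNS

open Set Real Filter
open _root_.Topology

/-- The retuned circuit is a smooth vector field (five smooth gates, `delayCircuitWith_eq_gates`).
[cite: Tao2016AveragedNS, §5.5 (5.5)] -/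
theorem contDiff_delayCircuitWith (K M ε : ℝ) {n : WithTop ℕ∞} :
    ContDiff ℝ n (delayCircuitWith K M ε) := by
  rw [delayCircuitWith_eq_gates]
  exact ((((contDiff_pumpOn _ _ _).add (contDiff_pumpOn _ _ _)).add
    (contDiff_amplifierOn _ _ _)).add (contDiff_rotorOn _ _ _ _)).add (contDiff_pumpOn _ _ _)

/-- A global solution of the retuned circuit from the kicked datum exists (the field cancels and is
polynomial). [cite: Tao2016AveragedNS, §5 (ode)–(g-cancel)] -/
theorem exists_solution_kickInit_with (K M ε κ : ℝ) :
    ∃ X : ℝ → Fin 5 → ℝ, X 0 = kickInit κ ∧ ∀ t, HasDerivAt X (delayCircuitWith K M ε (X t)) t :=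
  (isCancelling_delayCircuitWith K M ε).exists_solution (contDiff_delayCircuitWith K M ε) _

/-- The **kick ceiling** of the family's trigger channel with window tolerance `γ` and quiescent
length `s`: `2K¹⁰ε² · exp(-M(1 - 2γ - 4MK²⁰ε²)s²/2)` — a pre-load `κ` of `c` at or above it makes
the lower clock `κ·exp(M(1-2γ-4MK²⁰ε²)t²/2)` reach the rotor-turning level `2K¹⁰ε²` by time `s`
(`kickThreshold` of `TriggerFragility` is the member `M = K¹⁰`). [cite: Tao2016AveragedNS, §5.5 proof] -/
def kickCeilingWith (K M ε γ s : ℝ) : ℝ :=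
  2 * K ^ 10 * ε ^ 2 * exp (-(M * (1 - 2 * γ - 4 * M * K ^ 20 * ε ^ 2) * s ^ 2 / 2))

/-- The ceiling is positive. [cite: Tao2016AveragedNS, §5.5] -/
theorem kickCeilingWith_pos {K M ε : ℝ} (hK : 0 < K) (hε : 0 < ε) (γ s : ℝ) :
    0 < kickCeilingWith K M ε γ s := by
  unfold kickCeilingWith; positivity

/-- Tao's threshold is the member `M = K¹⁰` of the ceiling. [cite: Tao2016AveragedNS, §5.5] -/
theorem kickCeilingWith_pow_ten (K ε γ s : ℝ) :
    kickCeilingWith K (K ^ 10) ε γ s = kickThreshold K ε γ s := by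
  unfold kickCeilingWith kickThreshold; congr 2; ring

/-- **Quiet up to time `T` with tolerance `γ`**: `|a - 1| ≤ γ` and `|b|, |c|, |d|, |ã| ≤ γ` on
`[0, T]` — the shape of the quiet-phase conclusion of Theorem 5.3 (`transitionWith_explicit`,
`kickTransitionWith_explicit`: `γ = 200K⁻¹⁰`, `T = t_c ≥ √2 - 44 log K/M`).
[cite: Tao2016AveragedNS, Theorem 5.3] -/
def QuietUpTo (γ T : ℝ) (X : ℝ → Fin 5 → ℝ) : Prop :=
  ∀ t ∈ Icc 0 T, |X t 0 - 1| ≤ γ ∧ ∀ i : Fin 5, i ≠ 0 → |X t i| ≤ γ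

/-- A quiet phase gives the window bounds used by the trigger-channel argument.
[cite: Tao2016AveragedNS, Theorem 5.3] -/
theorem QuietUpTo.window {γ T : ℝ} {X : ℝ → Fin 5 → ℝ} (h : QuietUpTo γ T X) :
    ∀ t ∈ Icc 0 T, 1 - γ ≤ X t 0 ∧ |X t 3| ≤ γ ∧ |X t 4| ≤ γ := by
  intro t ht
  obtain ⟨ha, hi⟩ := h t ht
  exact ⟨by have := (abs_le.1 ha).1; linarith, hi 3 (by decide), hi 4 (by decide)⟩

/-- Quietness is monotone in the horizon. [cite: Tao2016AveragedNS, Theorem 5.3] -/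
theorem QuietUpTo.mono {γ T T' : ℝ} {X : ℝ → Fin 5 → ℝ} (h : QuietUpTo γ T X) (hT : T' ≤ T) :
    QuietUpTo γ T' X := fun t ht => h t ⟨ht.1, ht.2.trans hT⟩

section KickedFamily

variable {K M ε κ : ℝ} {X : ℝ → Fin 5 → ℝ}

/-- The (b), (c), (d) component equations of a trajectory of `delayCircuitWith K M ε`, bundled
(the unbundled forms live in `RetunedTransition.lean`, which this file deliberately does not
import). [cite: Tao2016AveragedNS, §5.5 (5.5)] -/
theorem KickW.hasDerivAt_bcd (hX : ∀ t, HasDerivAt X (delayCircuitWith K M ε (X t)) t) (t : ℝ) :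
    HasDerivAt (fun s => X s 1) (ε * X t 0 ^ 2 - ε⁻¹ * M * X t 2 ^ 2) t ∧
    HasDerivAt (fun s => X s 2) (ε ^ 2 * exp (-M) * X t 0 ^ 2 + ε⁻¹ * M * X t 1 * X t 2) t ∧
    HasDerivAt (fun s => X s 3) ((ε ^ 2)⁻¹ * X t 2 * X t 0 - K * X t 3 * X t 4) t :=
  ⟨(hasDerivAt_pi.1 (hX t) 1).congr_deriv (by simp [delayCircuitWith]),
   (hasDerivAt_pi.1 (hX t) 2).congr_deriv (by simp [delayCircuitWith]),
   (hasDerivAt_pi.1 (hX t) 3).congr_deriv (by simp [delayCircuitWith])⟩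

/-- Energy conservation along a kicked trajectory of the family.
[cite: Tao2016AveragedNS, §5.5 (energy-con)] -/
theorem kickW_energy (hX : ∀ t, HasDerivAt X (delayCircuitWith K M ε (X t)) t)
    (h0 : X 0 = kickInit κ) (hκ : κ ^ 2 ≤ 1) (t : ℝ) : energy (X t) = 1 := by
  rw [delayCircuitWith_energy hX t 0, h0, energy_kickInit hκ]

/-- Each mode of a kicked trajectory of the family has square at most one.
[cite: Tao2016AveragedNS, §5.5] -/
theorem kickW_sq_le_one (hX : ∀ t, HasDerivAt X (delayCircuitWith K M ε (X t)) t)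
    (h0 : X 0 = kickInit κ) (hκ : κ ^ 2 ≤ 1) (t : ℝ) (i : Fin 5) : X t i ^ 2 ≤ 1 := by
  have h := kickW_energy hX h0 hκ t
  rw [energy] at h
  rw [← h]
  exact Finset.single_le_sum (f := fun j => X t j ^ 2) (fun j _ => sq_nonneg _) (Finset.mem_univ i)

/-- The pump variable obeys `b(t) ≤ εt` for `t ≥ 0` (`∂ₜb = εa² - ε⁻¹Mc² ≤ ε`, `M ≥ 0`).
[cite: Tao2016AveragedNS, §5.5 (5.5) b-equation] -/
theorem kickW_b_le (hX : ∀ t, HasDerivAt X (delayCircuitWith K M ε (X t)) t) (h0 : X 0 = kickInit κ)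
    (hκ : κ ^ 2 ≤ 1) (hM : 0 ≤ M) (hε : 0 ≤ ε) {t : ℝ} (ht : 0 ≤ t) : X t 1 ≤ ε * t := by
  have hanti := Thm53.antitoneOn_sub_of_deriv_le (convex_Ici 0)
    (fun s _ => (KickW.hasDerivAt_bcd hX s).1) (fun s _ => (hasDerivAt_id s).const_mul ε)
    (fun s _ => by
      have ha : X s 0 ^ 2 ≤ 1 := kickW_sq_le_one hX h0 hκ s 0
      have h1 : ε * X s 0 ^ 2 ≤ ε := by simpa using mul_le_mul_of_nonneg_left ha hε
      have h2 : 0 ≤ ε⁻¹ * M * X s 2 ^ 2 := by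
        have : 0 ≤ ε⁻¹ := inv_nonneg.2 hε
        positivity
      simpa using (show ε * X s 0 ^ 2 - ε⁻¹ * M * X s 2 ^ 2 ≤ ε by linarith))
  have hmono := hanti (self_mem_Ici (a := (0 : ℝ))) (mem_Ici.2 ht) ht
  simp only [kick_init_b h0, id, mul_zero, sub_zero] at hmono
  linarith

/-- **The trigger stays non-negative** (indeed `c(t) ≥ κ·exp(∫₀ᵗ ε⁻¹Mb) > 0`): integrating
factor `exp(-∫₀ᵗ ε⁻¹Mb)`, as in the proof of Theorem 5.3. [cite: Tao2016AveragedNS, §5.5 proof] -/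
theorem kickW_c_nonneg (hX : ∀ t, HasDerivAt X (delayCircuitWith K M ε (X t)) t) (h0 : X 0 = kickInit κ)
    (hκ0 : 0 ≤ κ) {t : ℝ} (ht : 0 ≤ t) : 0 ≤ X t 2 := by
  set G : ℝ → ℝ := fun s => ∫ r in (0 : ℝ)..s, ε⁻¹ * M * X r 1 with hG
  have hGd : ∀ s, HasDerivAt G (ε⁻¹ * M * X s 1) s := fun s =>
    ((continuous_const.mul ((continuous_apply 1).comp (continuous_iff_continuousAt.2 fun t => (hX t).continuousAt))).integral_hasStrictDerivAt 0 s).hasDerivAt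
  have hmono := Thm53.monotoneOn_intFactor (s := univ) (φ := fun _ => 0) (Φ := fun _ => 0)
    convex_univ (fun s _ => (KickW.hasDerivAt_bcd hX s).2.1) (fun s _ => hGd s)
    (fun s _ => hasDerivAt_const s (0 : ℝ))
    (fun s _ => by
      have : (ε ^ 2 * exp (-M) * X s 0 ^ 2 + ε⁻¹ * M * X s 1 * X s 2
          - ε⁻¹ * M * X s 1 * X s 2) * exp (-G s)
          = ε ^ 2 * exp (-M) * X s 0 ^ 2 * exp (-G s) := by ring
      rw [this]; positivity)
  have h := hmono (mem_univ 0) (mem_univ t) ht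
  have hG0 : G 0 = 0 := by simp [hG]
  simp only [kick_init_c h0, hG0, neg_zero, exp_zero, mul_one, sub_zero] at h
  exact (mul_nonneg_iff_of_pos_right (exp_pos (-G t))).1 (hκ0.trans h)

/-- **Upper growth of the trigger** on `[t₁, 2]` (`t₁ ≥ 0`):
`c(t) ≤ e^{2M(t-t₁)}(c(t₁) + ε²e^{-M}(t - t₁))`, from `∂ₜc ≤ ε²e^{-M} + 2Mc`
(`b ≤ εt ≤ 2ε`, `c ≥ 0`, `a² ≤ 1`). [cite: Tao2016AveragedNS, §5.5 (code)] -/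
theorem kickW_c_growth (hX : ∀ t, HasDerivAt X (delayCircuitWith K M ε (X t)) t)
    (h0 : X 0 = kickInit κ) (hκ0 : 0 ≤ κ) (hκ : κ ^ 2 ≤ 1) (hM : 0 ≤ M) (hε : 0 < ε) {t₁ t : ℝ}
    (ht₁ : 0 ≤ t₁) (ht : t ∈ Icc t₁ 2) :
    X t 2 ≤ exp (2 * M * (t - t₁)) * (X t₁ 2 + ε ^ 2 * exp (-M) * (t - t₁)) := by
  set μ : ℝ := ε ^ 2 * exp (-M) with hμ
  have hμ0 : 0 ≤ μ := by positivity
  have hanti := Thm53.antitoneOn_intFactor (s := Icc t₁ 2) (f := fun s => X s 2)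
    (g := fun _ => 2 * M) (G := fun s => 2 * M * (s - t₁)) (φ := fun _ => μ)
    (Φ := fun s => μ * (s - t₁)) (convex_Icc t₁ 2)
    (fun s _ => (KickW.hasDerivAt_bcd hX s).2.1)
    (fun s _ => (((hasDerivAt_id s).sub_const t₁).const_mul (2 * M)).congr_deriv (by simp))
    (fun s _ => (((hasDerivAt_id s).sub_const t₁).const_mul μ).congr_deriv (by simp))
    (fun s hs => by
      have hs0 : 0 ≤ s := ht₁.trans hs.1
      have hc0 : 0 ≤ X s 2 := kickW_c_nonneg hX h0 hκ0 hs0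
      have hb : X s 1 ≤ 2 * ε := (kickW_b_le hX h0 hκ hM hε.le hs0).trans (by nlinarith [hs.2])
      have ha : X s 0 ^ 2 ≤ 1 := kickW_sq_le_one hX h0 hκ s 0
      have hexp : exp (-(2 * M * (s - t₁))) ≤ 1 := by
        rw [exp_le_one_iff, neg_nonpos]
        have : 0 ≤ s - t₁ := by linarith [hs.1]
        positivity
      have hk : 0 ≤ M := hM
      have h1 : ε ^ 2 * exp (-M) * X s 0 ^ 2 ≤ μ := by
        simpa [hμ] using mul_le_mul_of_nonneg_left ha (by positivity : 0 ≤ ε ^ 2 * exp (-M))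
      have h2 : ε⁻¹ * M * X s 1 * X s 2 ≤ 2 * M * X s 2 := by
        have h5 : ε⁻¹ * X s 1 ≤ 2 := by rw [inv_mul_le_iff₀ hε]; linarith
        have : ε⁻¹ * M * X s 1 * X s 2 = (ε⁻¹ * X s 1) * (M * X s 2) := by ring
        rw [this]
        nlinarith [mul_nonneg hk hc0]
      have hbr : ε ^ 2 * exp (-M) * X s 0 ^ 2 + ε⁻¹ * M * X s 1 * X s 2
          - 2 * M * X s 2 ≤ μ := by linarith
      calc (ε ^ 2 * exp (-M) * X s 0 ^ 2 + ε⁻¹ * M * X s 1 * X s 2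
            - 2 * M * X s 2) * exp (-(2 * M * (s - t₁)))
          ≤ μ * exp (-(2 * M * (s - t₁))) := mul_le_mul_of_nonneg_right hbr (exp_pos _).le
        _ ≤ μ * 1 := mul_le_mul_of_nonneg_left hexp hμ0
        _ = μ := mul_one _)
  have h1mem : t₁ ∈ Icc t₁ 2 := ⟨le_rfl, ht.1.trans ht.2⟩
  have h := hanti h1mem ht ht.1
  simp only [sub_self, mul_zero, neg_zero, exp_zero, mul_one, sub_zero] at h
  have h' : X t 2 * exp (-(2 * M * (t - t₁))) ≤ X t₁ 2 + μ * (t - t₁) := by linarith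
  have hexp : X t 2 = X t 2 * exp (-(2 * M * (t - t₁))) * exp (2 * M * (t - t₁)) := by
    rw [mul_assoc, ← exp_add, neg_add_cancel, exp_zero, mul_one]
  rw [hexp]
  calc X t 2 * exp (-(2 * M * (t - t₁))) * exp (2 * M * (t - t₁))
      ≤ (X t₁ 2 + μ * (t - t₁)) * exp (2 * M * (t - t₁)) :=
        mul_le_mul_of_nonneg_right h' (exp_pos _).le
    _ = exp (2 * M * (t - t₁)) * (X t₁ 2 + μ * (t - t₁)) := by ring

/-- Window step 1 — **the pump under the window bound**: if `a ≥ 1 - γ` (`γ ≤ 1`) and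
`c ≤ 2K¹⁰ε²` hold on `[0, τ]`, then `b(t) ≥ ε(1 - 2γ - 4MK²⁰ε²)t` there
(`∂ₜb = εa² - ε⁻¹Mc² ≥ ε(1-2γ) - 4MK²⁰ε³`). [cite: Tao2016AveragedNS, §5.5 (5.5) b-equation] -/
theorem kickW_b_lower (hX : ∀ t, HasDerivAt X (delayCircuitWith K M ε (X t)) t)
    (h0 : X 0 = kickInit κ) (hκ0 : 0 ≤ κ) (hM : 0 ≤ M) (hε : 0 < ε) {γ τ : ℝ} (hγ : γ ≤ 1)
    (hWa : ∀ t ∈ Icc 0 τ, 1 - γ ≤ X t 0) (hc : ∀ t ∈ Icc 0 τ, X t 2 ≤ 2 * K ^ 10 * ε ^ 2)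
    {t : ℝ} (ht : t ∈ Icc 0 τ) : ε * (1 - 2 * γ - 4 * M * K ^ 20 * ε ^ 2) * t ≤ X t 1 := by
  have hεne : ε ≠ 0 := hε.ne'
  have hmono := Thm53.monotoneOn_sub_of_le_deriv (s := Icc 0 τ) (f := fun t => X t 1)
    (φ := fun _ => ε * (1 - 2 * γ - 4 * M * K ^ 20 * ε ^ 2))
    (Φ := fun t => ε * (1 - 2 * γ - 4 * M * K ^ 20 * ε ^ 2) * t) (convex_Icc 0 τ)
    (fun s _ => (KickW.hasDerivAt_bcd hX s).1)
    (fun s _ => ((hasDerivAt_id s).const_mul (ε * (1 - 2 * γ - 4 * M * K ^ 20 * ε ^ 2))).congr_deriv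
      (by simp))
    (fun s hs => by
      show ε * (1 - 2 * γ - 4 * M * K ^ 20 * ε ^ 2) ≤ ε * X s 0 ^ 2 - ε⁻¹ * M * X s 2 ^ 2
      have ha : 1 - γ ≤ X s 0 := hWa s hs
      have hsq : (1 - γ) ^ 2 ≤ X s 0 ^ 2 := pow_le_pow_left₀ (by linarith) ha 2
      have ha2 : 1 - 2 * γ ≤ X s 0 ^ 2 := by nlinarith [sq_nonneg γ]
      have hc0 : 0 ≤ X s 2 := kickW_c_nonneg hX h0 hκ0 hs.1
      have hc2 : X s 2 ^ 2 ≤ (2 * K ^ 10 * ε ^ 2) ^ 2 := pow_le_pow_left₀ hc0 (hc s hs) 2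
      have h3 : ε⁻¹ * M * X s 2 ^ 2 ≤ 4 * M * K ^ 20 * ε ^ 3 := by
        calc ε⁻¹ * M * X s 2 ^ 2 ≤ ε⁻¹ * M * (2 * K ^ 10 * ε ^ 2) ^ 2 :=
              mul_le_mul_of_nonneg_left hc2 (by positivity)
          _ = 4 * M * K ^ 20 * ε ^ 3 := by field_simp; ring
      have h5 : ε * (1 - 2 * γ) ≤ ε * X s 0 ^ 2 := mul_le_mul_of_nonneg_left ha2 hε.le
      have h6 : ε * (1 - 2 * γ - 4 * M * K ^ 20 * ε ^ 2) = ε * (1 - 2 * γ) - 4 * M * K ^ 20 * ε ^ 3 := by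
        ring
      rw [h6]; linarith)
  have h := hmono ⟨le_rfl, ht.1.trans ht.2⟩ ht ht.1
  simp only [kick_init_b h0, mul_zero, sub_zero] at h
  linarith

/-- Window step 2 — **the lower clock**: if `b(t) ≥ εrt` on `[0, τ]` then
`c(t) ≥ κ·exp(Mrt²/2)` there (integrating factor `exp(-Mrt²/2)`; `c ≥ 0`): the family's
`exp(Mt²/2 - M)` clock (`RetunedTransition`) with the seed replaced by the pre-load `κ`.
[cite: Tao2016AveragedNS, §5.5 proof] -/
theorem kickW_c_lower (hX : ∀ t, HasDerivAt X (delayCircuitWith K M ε (X t)) t)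
    (h0 : X 0 = kickInit κ) (hκ0 : 0 ≤ κ) (hM : 0 ≤ M) (hε : 0 < ε) {r τ : ℝ}
    (hb : ∀ t ∈ Icc 0 τ, ε * r * t ≤ X t 1)
    {t : ℝ} (ht : t ∈ Icc 0 τ) : κ * exp (M * r * t ^ 2 / 2) ≤ X t 2 := by
  have hεne : ε ≠ 0 := hε.ne'
  have hmono := Thm53.monotoneOn_intFactor (s := Icc 0 τ) (f := fun t => X t 2)
    (g := fun t => M * r * t) (G := fun t => M * r * t ^ 2 / 2)
    (φ := fun _ => 0) (Φ := fun _ => 0) (convex_Icc 0 τ)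
    (fun s _ => (KickW.hasDerivAt_bcd hX s).2.1)
    (fun s _ => by
      refine (((hasDerivAt_pow 2 s).const_mul (M * r)).div_const 2).congr_deriv ?_
      simp only [show (2 : ℕ) - 1 = 1 from rfl, pow_one, Nat.cast_ofNat]
      ring)
    (fun s _ => hasDerivAt_const s (0 : ℝ))
    (fun s hs => by
      show (0 : ℝ) ≤ (ε ^ 2 * exp (-M) * X s 0 ^ 2 + ε⁻¹ * M * X s 1 * X s 2
          - M * r * s * X s 2) * exp (-(M * r * s ^ 2 / 2))
      have hc0 : 0 ≤ X s 2 := kickW_c_nonneg hX h0 hκ0 hs.1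
      have h1 : M * r * s ≤ ε⁻¹ * M * X s 1 := by
        have := mul_le_mul_of_nonneg_left (hb s hs) (by positivity : 0 ≤ ε⁻¹ * M)
        calc M * r * s = ε⁻¹ * M * (ε * r * s) := by field_simp
          _ ≤ ε⁻¹ * M * X s 1 := this
      have h2 : 0 ≤ (ε⁻¹ * M * X s 1 - M * r * s) * X s 2 :=
        mul_nonneg (by linarith) hc0
      have h3 : 0 ≤ ε ^ 2 * exp (-M) * X s 0 ^ 2 := by positivity
      have h4 : 0 ≤ ε ^ 2 * exp (-M) * X s 0 ^ 2 + ε⁻¹ * M * X s 1 * X s 2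
          - M * r * s * X s 2 := by
        have : ε ^ 2 * exp (-M) * X s 0 ^ 2 + ε⁻¹ * M * X s 1 * X s 2
            - M * r * s * X s 2 = ε ^ 2 * exp (-M) * X s 0 ^ 2
              + (ε⁻¹ * M * X s 1 - M * r * s) * X s 2 := by ring
        rw [this]; exact add_nonneg h3 h2
      exact mul_nonneg h4 (exp_pos _).le)
  have h := hmono ⟨le_rfl, ht.1.trans ht.2⟩ ht ht.1
  simp only [kick_init_c h0, ne_eq, OfNat.ofNat_ne_zero, not_false_eq_true, zero_pow, mul_zero,
    zero_div, neg_zero, exp_zero, mul_one, sub_zero] at h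
  calc κ * exp (M * r * t ^ 2 / 2)
      ≤ X t 2 * exp (-(M * r * t ^ 2 / 2)) * exp (M * r * t ^ 2 / 2) :=
        mul_le_mul_of_nonneg_right h (exp_pos _).le
    _ = X t 2 := by rw [mul_assoc, ← exp_add, neg_add_cancel, exp_zero, mul_one]

/-- Window step 3 — **the pump keeps its sign**: if `a ≥ 1 - γ` (`γ ≤ 1/8`) and `c ≤ 9K¹⁰ε²` hold
on `[0, T₂]` (`169MK²⁰ε² ≤ 1`), then `b ≥ 0` there (`∂ₜb ≥ ε(3/4) - 81MK²⁰ε³ ≥ 0`).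
[cite: Tao2016AveragedNS, §5.5 (5.5) b-equation] -/
theorem kickW_b_nonneg (hX : ∀ t, HasDerivAt X (delayCircuitWith K M ε (X t)) t)
    (h0 : X 0 = kickInit κ) (hκ0 : 0 ≤ κ) (hM : 0 ≤ M) (hε : 0 < ε)
    (hMε : 169 * M * K ^ 20 * ε ^ 2 ≤ 1) {γ T₂ : ℝ}
    (hγ : γ ≤ 1 / 8) (hWa : ∀ t ∈ Icc 0 T₂, 1 - γ ≤ X t 0)
    (hc : ∀ t ∈ Icc 0 T₂, X t 2 ≤ 9 * K ^ 10 * ε ^ 2) {t : ℝ} (ht : t ∈ Icc 0 T₂) :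
    0 ≤ X t 1 := by
  have hεne : ε ≠ 0 := hε.ne'
  have hmono := Thm53.monotoneOn_sub_of_le_deriv (s := Icc 0 T₂) (f := fun t => X t 1)
    (φ := fun _ => 0) (Φ := fun _ => 0) (convex_Icc 0 T₂)
    (fun s _ => (KickW.hasDerivAt_bcd hX s).1) (fun s _ => hasDerivAt_const s (0 : ℝ))
    (fun s hs => by
      show (0 : ℝ) ≤ ε * X s 0 ^ 2 - ε⁻¹ * M * X s 2 ^ 2
      have ha : 1 - γ ≤ X s 0 := hWa s hs
      have hsq : (1 - γ) ^ 2 ≤ X s 0 ^ 2 := pow_le_pow_left₀ (by linarith) ha 2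
      have ha2 : 1 - 2 * γ ≤ X s 0 ^ 2 := by nlinarith [sq_nonneg γ]
      have hc0 : 0 ≤ X s 2 := kickW_c_nonneg hX h0 hκ0 hs.1
      have hc2 : X s 2 ^ 2 ≤ (9 * K ^ 10 * ε ^ 2) ^ 2 := pow_le_pow_left₀ hc0 (hc s hs) 2
      have h3 : ε⁻¹ * M * X s 2 ^ 2 ≤ 81 * M * K ^ 20 * ε ^ 3 := by
        calc ε⁻¹ * M * X s 2 ^ 2 ≤ ε⁻¹ * M * (9 * K ^ 10 * ε ^ 2) ^ 2 :=
              mul_le_mul_of_nonneg_left hc2 (by positivity)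
          _ = 81 * M * K ^ 20 * ε ^ 3 := by field_simp; ring
      have h4 : 81 * M * K ^ 20 * ε ^ 3 ≤ ε * (1 / 2) := by
        have h81 : 81 * M * K ^ 20 * ε ^ 2 ≤ 1 / 2 := by
          have : 0 ≤ M * K ^ 20 * ε ^ 2 := by positivity
          linarith
        have : 81 * M * K ^ 20 * ε ^ 3 = ε * (81 * M * K ^ 20 * ε ^ 2) := by ring
        rw [this]; exact mul_le_mul_of_nonneg_left h81 hε.le
      have h5 : ε * (3 / 4) ≤ ε * X s 0 ^ 2 := mul_le_mul_of_nonneg_left (by linarith) hε.le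
      linarith)
  have h := hmono ⟨le_rfl, ht.1.trans ht.2⟩ ht ht.1
  simp only [kick_init_b h0, sub_zero] at h
  exact h

/-- Window step 4 — **the trigger holds its level**: if `b ≥ 0` on `[0, T₂]` then `c` is
non-decreasing there (`∂ₜc = ε²e^{-M}a² + ε⁻¹Mbc ≥ 0`, `M ≥ 0`). [cite: Tao2016AveragedNS, §5.5 proof] -/
theorem kickW_c_monotoneOn (hX : ∀ t, HasDerivAt X (delayCircuitWith K M ε (X t)) t)
    (h0 : X 0 = kickInit κ) (hκ0 : 0 ≤ κ) (hM : 0 ≤ M) (hε : 0 ≤ ε) {T₂ : ℝ}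
    (hb : ∀ t ∈ Icc 0 T₂, 0 ≤ X t 1) : MonotoneOn (fun t => X t 2) (Icc 0 T₂) := by
  have hmono := Thm53.monotoneOn_sub_of_le_deriv (s := Icc 0 T₂) (f := fun t => X t 2)
    (φ := fun _ => 0) (Φ := fun _ => 0) (convex_Icc 0 T₂)
    (fun s _ => (KickW.hasDerivAt_bcd hX s).2.1) (fun s _ => hasDerivAt_const s (0 : ℝ))
    (fun s hs => by
      show (0 : ℝ) ≤ ε ^ 2 * exp (-M) * X s 0 ^ 2 + ε⁻¹ * M * X s 1 * X s 2
      have hc0 : 0 ≤ X s 2 := kickW_c_nonneg hX h0 hκ0 hs.1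
      have hb0 : 0 ≤ X s 1 := hb s hs
      have : 0 ≤ ε⁻¹ := inv_nonneg.2 hε
      positivity)
  simpa using hmono

/-- Window step 5 — **the rotor turns**: if on `[τ, τ + Δ]` one has `c ≥ 2K¹⁰ε²`, `a ≥ 1 - γ` and
`|d|, |ã| ≤ γ` (`γ ≤ 1/8`, `K ≥ 1`), then `∂ₜd = ε⁻²ca - Kdã ≥ K¹⁰` and `d(τ + Δ) ≥ d(τ) + K¹⁰Δ`:
the rotor equation carries no `M`, so this is `kick_d_growth` verbatim for the family.
[cite: Tao2016AveragedNS, §5.5 (5.5) d-equation] -/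
theorem kickW_d_growth (hX : ∀ t, HasDerivAt X (delayCircuitWith K M ε (X t)) t) (hK : 1 ≤ K)
    (hε : 0 < ε) {γ τ Δ : ℝ} (hγ : γ ≤ 1 / 8) (hΔ : 0 ≤ Δ)
    (hc : ∀ t ∈ Icc τ (τ + Δ), 2 * K ^ 10 * ε ^ 2 ≤ X t 2)
    (hW : ∀ t ∈ Icc τ (τ + Δ), 1 - γ ≤ X t 0 ∧ |X t 3| ≤ γ ∧ |X t 4| ≤ γ) :
    X τ 3 + K ^ 10 * Δ ≤ X (τ + Δ) 3 := by
  have hεne : ε ≠ 0 := hε.ne'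
  have hK0 : 0 < K := by linarith
  have hKK : K ≤ K ^ 10 := by
    calc K = K ^ 1 := (pow_one K).symm
      _ ≤ K ^ 10 := pow_le_pow_right₀ hK (by norm_num)
  have hγ0 : 0 ≤ γ := (abs_nonneg _).trans (hW τ ⟨le_rfl, by linarith⟩).2.1
  have hmono := Thm53.monotoneOn_sub_of_le_deriv (s := Icc τ (τ + Δ)) (f := fun t => X t 3)
    (φ := fun _ => K ^ 10) (Φ := fun t => K ^ 10 * t) (convex_Icc τ (τ + Δ))
    (fun s _ => (KickW.hasDerivAt_bcd hX s).2.2)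
    (fun s _ => ((hasDerivAt_id s).const_mul (K ^ 10)).congr_deriv (by simp))
    (fun s hs => by
      show K ^ 10 ≤ (ε ^ 2)⁻¹ * X s 2 * X s 0 - K * X s 3 * X s 4
      obtain ⟨ha, hd, he⟩ := hW s hs
      have hcs : 2 * K ^ 10 * ε ^ 2 ≤ X s 2 := hc s hs
      have hc₁0 : (0 : ℝ) ≤ 2 * K ^ 10 * ε ^ 2 := by positivity
      have hca : 2 * K ^ 10 * ε ^ 2 * (1 - γ) ≤ X s 2 * X s 0 :=
        mul_le_mul hcs ha (by linarith) (hc₁0.trans hcs)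
      have h1 : 2 * K ^ 10 * (1 - γ) ≤ (ε ^ 2)⁻¹ * X s 2 * X s 0 := by
        calc 2 * K ^ 10 * (1 - γ) = (ε ^ 2)⁻¹ * (2 * K ^ 10 * ε ^ 2 * (1 - γ)) := by field_simp
          _ ≤ (ε ^ 2)⁻¹ * (X s 2 * X s 0) := mul_le_mul_of_nonneg_left hca (by positivity)
          _ = (ε ^ 2)⁻¹ * X s 2 * X s 0 := by ring
      have h2 : K * X s 3 * X s 4 ≤ K * γ ^ 2 := by
        have : X s 3 * X s 4 ≤ γ ^ 2 := by
          calc X s 3 * X s 4 ≤ |X s 3 * X s 4| := le_abs_self _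
            _ = |X s 3| * |X s 4| := abs_mul _ _
            _ ≤ γ * γ := mul_le_mul hd he (abs_nonneg _) hγ0
            _ = γ ^ 2 := (sq γ).symm
        calc K * X s 3 * X s 4 = K * (X s 3 * X s 4) := by ring
          _ ≤ K * γ ^ 2 := mul_le_mul_of_nonneg_left this hK0.le
      have h3 : K * γ ^ 2 ≤ K ^ 10 * (1 / 64) := by
        have hγ2 : γ ^ 2 ≤ 1 / 64 := by nlinarith
        calc K * γ ^ 2 ≤ K * (1 / 64) := mul_le_mul_of_nonneg_left hγ2 hK0.le
          _ ≤ K ^ 10 * (1 / 64) := mul_le_mul_of_nonneg_right hKK (by norm_num)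
      have h4 : K ^ 10 * γ ≤ K ^ 10 * (1 / 8) := mul_le_mul_of_nonneg_left hγ (by positivity)
      have h5 : 2 * K ^ 10 * (1 - γ) = 2 * K ^ 10 - 2 * (K ^ 10 * γ) := by ring
      have hk : 0 ≤ K ^ 10 := by positivity
      linarith)
  have h := hmono ⟨le_rfl, by linarith⟩ ⟨by linarith, le_rfl⟩ (by linarith)
  have h5 : K ^ 10 * (τ + Δ) = K ^ 10 * τ + K ^ 10 * Δ := by ring
  simp only at h
  linarith

/-- **Core of the trigger channel, uniformly in the family.** For a global solution of
`delayCircuitWith K M ε` from `kickInit κ` with `kickCeilingWith K M ε γ s₀ ≤ κ ≤ ε²` (`K ≥ 1`,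
`0 ≤ M ≤ K¹⁰`, `0 < ε ≤ 1`, `169MK²⁰ε² ≤ 1`, `γ ≤ 1/8`, `0 < s₀`, `s₀ + 1/(2K¹⁰) ≤ 2`), the window
bounds `a ≥ 1 - γ`, `|d| ≤ γ`, `|ã| ≤ γ` CANNOT hold on all of `[0, s₀ + 1/(2K¹⁰)]`: the trigger
reaches `2K¹⁰ε²` by a time `t_* ≤ s₀` (lower clock `κe^{Mrt²/2}`, first hitting time), stays in
`[2K¹⁰ε², 9K¹⁰ε²]` on `[t_*, t_* + 1/(2K¹⁰)]` (`b ≥ 0`; Grönwall at rate `2M ≤ 2K¹⁰`), and the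
rotor `∂ₜd ≥ K¹⁰` moves `d` by `≥ 1/2 > 2γ`. The level `2K¹⁰ε²`, the step `1/(2K¹⁰)` and the cap
`9K¹⁰ε²` are those of `kick_core` (the rotor is not retuned); only the clock rate and the Grönwall
rate carry `M`. [cite: Tao2016AveragedNS, §5.5 proof] -/
theorem kickW_core (hX : ∀ t, HasDerivAt X (delayCircuitWith K M ε (X t)) t)
    (h0 : X 0 = kickInit κ) (hK : 1 ≤ K) (hM : 0 ≤ M) (hMK : M ≤ K ^ 10) (hε : 0 < ε)
    (hε1 : ε ≤ 1) (hMε : 169 * M * K ^ 20 * ε ^ 2 ≤ 1) (hκ0 : 0 < κ) (hκ : κ ≤ ε ^ 2)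
    {γ s₀ : ℝ} (hγ : γ ≤ 1 / 8) (hs₀ : 0 < s₀) (hs2 : s₀ + 1 / (2 * K ^ 10) ≤ 2)
    (hthr : kickCeilingWith K M ε γ s₀ ≤ κ)
    (hW : ∀ t ∈ Icc 0 (s₀ + 1 / (2 * K ^ 10)), 1 - γ ≤ X t 0 ∧ |X t 3| ≤ γ ∧ |X t 4| ≤ γ) :
    False := by
  set Δ : ℝ := 1 / (2 * K ^ 10) with hΔ
  -- arithmetic of the constants
  have hK0 : 0 < K := by linarith
  have hKne : K ≠ 0 := hK0.ne'
  have hK10 : 1 ≤ K ^ 10 := one_le_pow₀ hK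
  have hΔ0 : 0 < Δ := by positivity
  have hΔ1 : Δ ≤ 1 / 2 := one_div_le_one_div_of_le (by norm_num) (by linarith)
  have hKΔ : K ^ 10 * Δ = 1 / 2 := by rw [hΔ]; field_simp
  have hε2 : 0 < ε ^ 2 := by positivity
  have hεsq : ε ^ 2 ≤ 1 := by nlinarith
  have hMΔ : M * Δ ≤ 1 / 2 := by
    calc M * Δ ≤ K ^ 10 * Δ := mul_le_mul_of_nonneg_right hMK hΔ0.le
      _ = 1 / 2 := hKΔ
  have hκ1 : κ ≤ 1 := hκ.trans hεsq
  have hκsq : κ ^ 2 ≤ 1 := by nlinarith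
  have hεK : ε ^ 2 ≤ K ^ 10 * ε ^ 2 := le_mul_of_one_le_left hε2.le hK10
  have hσε : ε ^ 2 * exp (-M) ≤ ε ^ 2 := by
    have : exp (-M) ≤ 1 := by rw [exp_le_one_iff, neg_nonpos]; exact hM
    simpa using mul_le_mul_of_nonneg_left this hε2.le
  have hσ0 : 0 ≤ ε ^ 2 * exp (-M) := by positivity
  have hκc₁ : κ < 2 * K ^ 10 * ε ^ 2 := hκ.trans_lt (by linarith)
  -- the first hitting time `τ ≤ s₀` of the level `2K¹⁰ε²` by the trigger
  have hcont : Continuous fun t => X t 2 := (continuous_apply 2).comp (continuous_iff_continuousAt.2 fun t => (hX t).continuousAt)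
  have hc00 : X 0 2 < 2 * K ^ 10 * ε ^ 2 := by rw [kick_init_c h0]; exact hκc₁
  obtain ⟨τ, hτ0, hτs, hcle, hhit⟩ :=
    Thm53.exists_hitTime (u := fun t => X t 2) (θ := 2 * K ^ 10 * ε ^ 2) hcont hs₀ hc00
  have hτW : τ ≤ s₀ + Δ := by linarith
  have hτΔW : τ + Δ ≤ s₀ + Δ := by linarith
  -- steps 1–2 on `[0, τ]`: `b ≥ εrt`, `c ≥ κe^{K¹⁰rt²/2}`; hence `c(τ) ≥ 2K¹⁰ε²`
  have hP1b : ∀ t ∈ Icc 0 τ, ε * (1 - 2 * γ - 4 * M * K ^ 20 * ε ^ 2) * t ≤ X t 1 := fun t ht =>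
    kickW_b_lower hX h0 hκ0.le hM hε (by linarith) (fun s hs => (hW s ⟨hs.1, hs.2.trans hτW⟩).1)
      (fun s hs => hcle s hs.1 hs.2) ht
  have hcτ : 2 * K ^ 10 * ε ^ 2 ≤ X τ 2 := by
    rcases hτs.lt_or_eq with hlt | heq
    · exact (hhit hlt).ge
    · have h := kickW_c_lower hX h0 hκ0.le hM hε hP1b (t := τ) ⟨hτ0.le, le_rfl⟩
      have h1 : kickCeilingWith K M ε γ s₀ *
          exp (M * (1 - 2 * γ - 4 * M * K ^ 20 * ε ^ 2) * s₀ ^ 2 / 2) = 2 * K ^ 10 * ε ^ 2 := by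
        rw [kickCeilingWith, mul_assoc (2 * K ^ 10 * ε ^ 2), ← exp_add, neg_add_cancel, exp_zero,
          mul_one]
      rw [heq] at h ⊢
      calc 2 * K ^ 10 * ε ^ 2
          = kickCeilingWith K M ε γ s₀ *
              exp (M * (1 - 2 * γ - 4 * M * K ^ 20 * ε ^ 2) * s₀ ^ 2 / 2) := h1.symm
        _ ≤ κ * exp (M * (1 - 2 * γ - 4 * M * K ^ 20 * ε ^ 2) * s₀ ^ 2 / 2) :=
            mul_le_mul_of_nonneg_right hthr (exp_pos _).le
        _ ≤ X s₀ 2 := h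
  -- Grönwall step: `c ≤ 9K¹⁰ε²` on `[0, τ + Δ]`
  have hc3 : ∀ t ∈ Icc 0 (τ + Δ), X t 2 ≤ 9 * K ^ 10 * ε ^ 2 := by
    intro t ht
    rcases le_or_gt t τ with htτ | htτ
    · exact (hcle t ht.1 htτ).trans (by linarith)
    · have hg := kickW_c_growth hX h0 hκ0.le hκsq hM hε hτ0.le ⟨htτ.le, by linarith [ht.2]⟩
      have hdt : t - τ ≤ Δ := by linarith [ht.2]
      have hdt0 : 0 ≤ t - τ := by linarith
      have he1 : exp (2 * M * (t - τ)) ≤ 3 := by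
        have h1 : M * (t - τ) ≤ M * Δ := mul_le_mul_of_nonneg_left hdt hM
        have : 2 * M * (t - τ) ≤ 1 := by linarith
        calc exp (2 * M * (t - τ)) ≤ exp 1 := exp_le_exp.2 this
          _ ≤ 3 := (Real.exp_one_lt_d9.trans (by norm_num)).le
      have hcτ1 : X τ 2 ≤ 2 * K ^ 10 * ε ^ 2 := hcle τ hτ0.le le_rfl
      have hσ1 : ε ^ 2 * exp (-M) * (t - τ) ≤ ε ^ 2 := by
        have : t - τ ≤ 1 := by linarith
        calc ε ^ 2 * exp (-M) * (t - τ) ≤ ε ^ 2 * exp (-M) * 1 :=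
              mul_le_mul_of_nonneg_left this hσ0
          _ ≤ ε ^ 2 := by rw [mul_one]; exact hσε
      have hsum : X τ 2 + ε ^ 2 * exp (-M) * (t - τ) ≤ 3 * K ^ 10 * ε ^ 2 := by linarith
      have hsum0 : 0 ≤ X τ 2 + ε ^ 2 * exp (-M) * (t - τ) := by
        have := kickW_c_nonneg hX h0 hκ0.le hτ0.le; positivity
      calc X t 2 ≤ exp (2 * M * (t - τ)) * (X τ 2 + ε ^ 2 * exp (-M) * (t - τ)) := hg
        _ ≤ 3 * (3 * K ^ 10 * ε ^ 2) := mul_le_mul he1 hsum hsum0 (by norm_num)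
        _ = 9 * K ^ 10 * ε ^ 2 := by ring
  -- steps 3–4 on `[0, τ + Δ]`: `b ≥ 0`, `c` non-decreasing, so `c ≥ 2K¹⁰ε²` on `[τ, τ + Δ]`
  have hb0 : ∀ t ∈ Icc 0 (τ + Δ), 0 ≤ X t 1 := fun t ht =>
    kickW_b_nonneg hX h0 hκ0.le hM hε hMε hγ (fun s hs => (hW s ⟨hs.1, hs.2.trans hτΔW⟩).1)
      hc3 ht
  have hcm := kickW_c_monotoneOn hX h0 hκ0.le hM hε.le hb0
  have hcge : ∀ t ∈ Icc τ (τ + Δ), 2 * K ^ 10 * ε ^ 2 ≤ X t 2 := fun t ht =>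
    hcτ.trans (hcm ⟨hτ0.le, by linarith⟩ ⟨hτ0.le.trans ht.1, ht.2⟩ ht.1)
  -- step 5: the rotor turns `d` by `K¹⁰Δ = 1/2 > 2γ` inside the window
  have hd1 : X τ 3 + K ^ 10 * Δ ≤ X (τ + Δ) 3 :=
    kickW_d_growth hX hK hε hγ hΔ0.le hcge fun t ht => hW t ⟨hτ0.le.trans ht.1, ht.2.trans hτΔW⟩
  have hdτ : -γ ≤ X τ 3 := (abs_le.1 (hW τ ⟨hτ0.le, hτW⟩).2.1).1
  have hdend : X (τ + Δ) 3 ≤ γ := (abs_le.1 (hW (τ + Δ) ⟨by linarith, hτΔW⟩).2.1).2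
  linarith


/-! ## Early firing above the ceiling, quietness below the tolerance -/

/-- **Kicks at or above the ceiling are incompatible with a quiet phase.** For every global
solution of `delayCircuitWith K M ε` from `kickInit κ` with `kickCeilingWith K M ε γ (T - 1/(2K¹⁰))
≤ κ ≤ ε²` (`K ≥ 1`, `0 ≤ M ≤ K¹⁰`, `0 < ε ≤ 1`, `169MK²⁰ε² ≤ 1`, `γ ≤ 1/8`, `1/(2K¹⁰) < T ≤ 2`),
the quiet bounds with tolerance `γ` fail somewhere on `[0, T]`. [cite: Tao2016AveragedNS, §5.5 proof] -/
theorem not_quietUpTo_of_kickCeilingWith_le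
    (hX : ∀ t, HasDerivAt X (delayCircuitWith K M ε (X t)) t) (h0 : X 0 = kickInit κ)
    (hK : 1 ≤ K) (hM : 0 ≤ M) (hMK : M ≤ K ^ 10) (hε : 0 < ε) (hε1 : ε ≤ 1)
    (hMε : 169 * M * K ^ 20 * ε ^ 2 ≤ 1) (hκ0 : 0 < κ) (hκ : κ ≤ ε ^ 2) {γ T : ℝ}
    (hγ : γ ≤ 1 / 8) (hT : 1 / (2 * K ^ 10) < T) (hT2 : T ≤ 2)
    (hthr : kickCeilingWith K M ε γ (T - 1 / (2 * K ^ 10)) ≤ κ) : ¬ QuietUpTo γ T X := by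
  intro hq
  refine kickW_core hX h0 hK hM hMK hε hε1 hMε hκ0 hκ hγ (s₀ := T - 1 / (2 * K ^ 10))
    (by linarith) (by linarith) hthr ?_
  intro t ht
  exact hq.window t ⟨ht.1, by linarith [ht.2]⟩

/-- The exponent of the ceiling at the Theorem-5.3 quiet phase (`γ = 200K⁻¹⁰`,
`s = √2 - 44 log K/M - 1/(2K¹⁰)`) is at least `M - 63 log K - 400M/K¹⁰ - 2`
(`K ≥ 2`, `1 ≤ M ≤ K¹⁰`, `8M²K²⁰ε² ≤ 1`; uses `√2 < 71/50`). [cite: Tao2016AveragedNS, §5.5] -/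
theorem ceilingExponent_ge (hK : 2 ≤ K) (hM1 : 1 ≤ M) (hMK : M ≤ K ^ 10)
    (hMε : 8 * M ^ 2 * K ^ 20 * ε ^ 2 ≤ 1) :
    M - 63 * Real.log K - (400 * M / K ^ 10 + 2) ≤
      M * (1 - 2 * (200 / K ^ 10) - 4 * M * K ^ 20 * ε ^ 2) *
        (Real.sqrt 2 - 44 * Real.log K / M - 1 / (2 * K ^ 10)) ^ 2 / 2 := by
  have hK0 : 0 < K := by linarith
  have hM : 0 ≤ M := by linarith
  have hMne : M ≠ 0 := by positivity
  have hK10 : (1024 : ℝ) ≤ K ^ 10 := le_trans (by norm_num) (pow_le_pow_left₀ (by norm_num) hK 10)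
  have hlog : 0 ≤ Real.log K := Real.log_nonneg (by linarith)
  set u : ℝ := 44 * Real.log K / M + 1 / (2 * K ^ 10) with hu
  set δ : ℝ := 400 / K ^ 10 + 4 * M * K ^ 20 * ε ^ 2 with hδ
  have hu0 : 0 ≤ u := by positivity
  have hδ0 : 0 ≤ δ := by positivity
  have hδ1 : δ ≤ 1 := by
    have h1 : 400 / K ^ 10 ≤ 1 / 2 := by rw [div_le_iff₀ (by positivity)]; linarith
    have h2 : 4 * M * K ^ 20 * ε ^ 2 ≤ 4 * M ^ 2 * K ^ 20 * ε ^ 2 := by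
      have h := mul_le_mul_of_nonneg_right hM1 hM
      have h' : 0 ≤ 4 * K ^ 20 * ε ^ 2 := by positivity
      nlinarith
    linarith
  have hsu : Real.sqrt 2 - 44 * Real.log K / M - 1 / (2 * K ^ 10) = Real.sqrt 2 - u := by
    rw [hu]; ring
  have hr : M * (1 - 2 * (200 / K ^ 10) - 4 * M * K ^ 20 * ε ^ 2) = M * (1 - δ) := by
    rw [hδ]; ring
  rw [hsu, hr]
  have h2sq : Real.sqrt 2 ^ 2 = 2 := Real.sq_sqrt (by norm_num)
  have hsq0 : 0 ≤ Real.sqrt 2 := Real.sqrt_nonneg 2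
  -- `s²/2 ≥ 1 - √2 u`
  have hs : 1 - Real.sqrt 2 * u ≤ (Real.sqrt 2 - u) ^ 2 / 2 := by nlinarith [sq_nonneg u]
  have h1 : M * (1 - δ) * (1 - Real.sqrt 2 * u) ≤ M * (1 - δ) * ((Real.sqrt 2 - u) ^ 2 / 2) :=
    mul_le_mul_of_nonneg_left hs (mul_nonneg hM (by linarith))
  have h2 : M * (1 - δ - Real.sqrt 2 * u) ≤ M * (1 - δ) * (1 - Real.sqrt 2 * u) := by
    have he : M * (1 - δ) * (1 - Real.sqrt 2 * u)
        = M * (1 - δ - Real.sqrt 2 * u) + M * (δ * (Real.sqrt 2 * u)) := by ring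
    have hpos : 0 ≤ M * (δ * (Real.sqrt 2 * u)) := by positivity
    linarith
  have h3 : M * δ ≤ 400 * M / K ^ 10 + 1 := by
    have he : M * δ = 400 * M / K ^ 10 + 4 * M ^ 2 * K ^ 20 * ε ^ 2 := by rw [hδ]; ring
    rw [he]; linarith
  have h4 : M * (Real.sqrt 2 * u) ≤ 63 * Real.log K + 1 := by
    have hsq := Thm53.sqrt_two_lt
    have hMu : M * u = 44 * Real.log K + M / (2 * K ^ 10) := by rw [hu]; field_simp
    have hM2 : M / (2 * K ^ 10) ≤ 1 / 2 := by rw [div_le_iff₀ (by positivity)]; linarith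
    have h44 : 0 ≤ 44 * Real.log K + M / (2 * K ^ 10) := by positivity
    calc M * (Real.sqrt 2 * u) = Real.sqrt 2 * (M * u) := by ring
      _ = Real.sqrt 2 * (44 * Real.log K + M / (2 * K ^ 10)) := by rw [hMu]
      _ ≤ 71 / 50 * (44 * Real.log K + 1 / 2) :=
          mul_le_mul hsq.le (by linarith) h44 (by norm_num)
      _ ≤ 63 * Real.log K + 1 := by linarith
  have he : M * (1 - δ - Real.sqrt 2 * u) = M - M * δ - M * (Real.sqrt 2 * u) := by ring
  linarith

/-- `e^{63 log K} = K⁶³`. [folklore] -/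
theorem exp_63_log {K : ℝ} (hK : 0 < K) : exp (63 * Real.log K) = K ^ 63 := by
  rw [show (63 : ℝ) * Real.log K = ((63 : ℕ) : ℝ) * Real.log K by norm_num, ← Real.log_pow,
    Real.exp_log (pow_pos hK 63)]

/-- **Size of the ceiling at the Theorem-5.3 quiet phase**:
`kickCeilingWith K M ε (200K⁻¹⁰) (√2 - 44 log K/M - 1/(2K¹⁰)) ≤ 2e^{400M/K¹⁰ + 2}·K⁷³·ε²e^{-M}`
(`K ≥ 2`, `1 ≤ M ≤ K¹⁰`, `8M²K²⁰ε² ≤ 1`), i.e. `≤ 2e^{400M/K¹⁰+2}K⁶³ × kickToleranceWith K M ε`: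
the undetermined band of pre-loads is polynomially wide in `K`, uniformly in the family.
[cite: Tao2016AveragedNS, §5.5] -/
theorem kickCeilingWith_le (hK : 2 ≤ K) (hM1 : 1 ≤ M) (hMK : M ≤ K ^ 10) (hε : 0 < ε)
    (hMε : 8 * M ^ 2 * K ^ 20 * ε ^ 2 ≤ 1) :
    kickCeilingWith K M ε (200 / K ^ 10) (Real.sqrt 2 - 44 * Real.log K / M - 1 / (2 * K ^ 10))
      ≤ 2 * exp (400 * M / K ^ 10 + 2) * K ^ 73 * (ε ^ 2 * exp (-M)) := by
  have hK0 : 0 < K := by linarith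
  have hkey := ceilingExponent_ge (ε := ε) hK hM1 hMK hMε
  unfold kickCeilingWith
  have hexp := exp_le_exp.2 (neg_le_neg hkey)
  have hsplit : exp (-(M - 63 * Real.log K - (400 * M / K ^ 10 + 2)))
      = exp (-M) * K ^ 63 * exp (400 * M / K ^ 10 + 2) := by
    rw [show -(M - 63 * Real.log K - (400 * M / K ^ 10 + 2))
        = -M + 63 * Real.log K + (400 * M / K ^ 10 + 2) by ring, exp_add, exp_add, exp_63_log hK0]
  calc 2 * K ^ 10 * ε ^ 2 * exp (-(M * (1 - 2 * (200 / K ^ 10) - 4 * M * K ^ 20 * ε ^ 2) *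
          (Real.sqrt 2 - 44 * Real.log K / M - 1 / (2 * K ^ 10)) ^ 2 / 2))
      ≤ 2 * K ^ 10 * ε ^ 2 * exp (-(M - 63 * Real.log K - (400 * M / K ^ 10 + 2))) :=
        mul_le_mul_of_nonneg_left hexp (by positivity)
    _ = 2 * exp (400 * M / K ^ 10 + 2) * K ^ 73 * (ε ^ 2 * exp (-M)) := by rw [hsplit]; ring

/-- The logarithmic members `M = p log K` (`1 ≤ p`, `400p ≤ K⁹`, `K ≥ 16`, `ε ≤ K⁻³⁰`): the ceiling
at the Theorem-5.3 quiet phase is `≤ 2e³ · ε² K^{73-p}` — a POWER of `K`, to be compared with the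
tolerance `ε² K^{10-p}` (`kickToleranceWith_log`). [cite: Tao2016AveragedNS, §5.5] -/
theorem kickCeilingWith_log_le (hK : 16 ≤ K) {p : ℕ} (hp : 1 ≤ p) (hpK : 400 * (p : ℝ) ≤ K ^ 9)
    (hε : 0 < ε) (hε30 : ε ≤ 1 / K ^ 30) :
    kickCeilingWith K (p * Real.log K) ε (200 / K ^ 10)
        (Real.sqrt 2 - 44 * Real.log K / (p * Real.log K) - 1 / (2 * K ^ 10))
      ≤ 2 * exp 3 * ε ^ 2 * K ^ 73 / K ^ p := by
  have hK0 : 0 < K := by linarith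
  have hK1 : (1 : ℝ) ≤ K := by linarith
  have hK2 : (2 : ℝ) ≤ K := by linarith
  have hlog2 : 2 ≤ Real.log K := by
    have he : exp 2 ≤ K := by
      have h1 := Real.exp_one_lt_d9
      have h0 : 0 < exp 1 := exp_pos 1
      have : exp 2 = exp 1 * exp 1 := by rw [← exp_add]; norm_num
      rw [this]; nlinarith
    calc (2 : ℝ) = Real.log (exp 2) := (Real.log_exp 2).symm
      _ ≤ Real.log K := Real.log_le_log (exp_pos 2) he
  have hlog0 : 0 < Real.log K := by linarith
  have hp1 : (1 : ℝ) ≤ p := by exact_mod_cast hp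
  have hM1 : 1 ≤ (p : ℝ) * Real.log K := by nlinarith
  have hlogK : Real.log K ≤ K := (Real.log_le_sub_one_of_pos hK0).trans (by linarith)
  have hMK9 : 400 * ((p : ℝ) * Real.log K) ≤ K ^ 10 := by
    calc 400 * ((p : ℝ) * Real.log K) = 400 * (p : ℝ) * Real.log K := by ring
      _ ≤ K ^ 9 * K := mul_le_mul hpK hlogK hlog0.le (by positivity)
      _ = K ^ 10 := by ring
  have hMK : (p : ℝ) * Real.log K ≤ K ^ 10 := by nlinarith
  have hMε : 8 * ((p : ℝ) * Real.log K) ^ 2 * K ^ 20 * ε ^ 2 ≤ 1 := by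
    have h1 : ((p : ℝ) * Real.log K) ^ 2 ≤ (K ^ 10) ^ 2 := pow_le_pow_left₀ (by positivity) hMK 2
    have h2 : ε ^ 2 ≤ (1 / K ^ 30) ^ 2 := pow_le_pow_left₀ hε.le hε30 2
    have hK20 : (8 : ℝ) ≤ K ^ 20 := le_trans (by norm_num) (pow_le_pow_left₀ (by norm_num) hK2 20)
    calc 8 * ((p : ℝ) * Real.log K) ^ 2 * K ^ 20 * ε ^ 2
        ≤ 8 * (K ^ 10) ^ 2 * K ^ 20 * (1 / K ^ 30) ^ 2 := by
          have h3 : 8 * ((p : ℝ) * Real.log K) ^ 2 * K ^ 20 ≤ 8 * (K ^ 10) ^ 2 * K ^ 20 :=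
            mul_le_mul_of_nonneg_right (mul_le_mul_of_nonneg_left h1 (by norm_num)) (by positivity)
          exact mul_le_mul h3 h2 (by positivity) (by positivity)
      _ = 8 / K ^ 20 := by field_simp
      _ ≤ 1 := by rw [div_le_one (by positivity)]; exact hK20
  have h := kickCeilingWith_le (ε := ε) hK2 hM1 hMK hε hMε
  have hA : exp (400 * ((p : ℝ) * Real.log K) / K ^ 10 + 2) ≤ exp 3 := by
    apply exp_le_exp.2
    have : 400 * ((p : ℝ) * Real.log K) / K ^ 10 ≤ 1 := by
      rw [div_le_one (by positivity)]; exact hMK9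
    linarith
  have hexpM : exp (-((p : ℝ) * Real.log K)) = (K ^ p)⁻¹ := by
    rw [Real.exp_neg, ← Real.log_pow, Real.exp_log (pow_pos hK0 p)]
  calc kickCeilingWith K (p * Real.log K) ε (200 / K ^ 10)
        (Real.sqrt 2 - 44 * Real.log K / (p * Real.log K) - 1 / (2 * K ^ 10))
      ≤ 2 * exp (400 * ((p : ℝ) * Real.log K) / K ^ 10 + 2) * K ^ 73 *
          (ε ^ 2 * exp (-((p : ℝ) * Real.log K))) := h
    _ ≤ 2 * exp 3 * K ^ 73 * (ε ^ 2 * exp (-((p : ℝ) * Real.log K))) := by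
        have : 0 ≤ K ^ 73 * (ε ^ 2 * exp (-((p : ℝ) * Real.log K))) := by positivity
        nlinarith
    _ = 2 * exp 3 * ε ^ 2 * K ^ 73 / K ^ p := by rw [hexpM]; ring

end KickedFamily

end Literature.Analysis.FluidPDE.Tao2016AveragedNS
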